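import Mathlib
import Literature.Analysis.FluidPDE.Tao2016AveragedNS.BoundedEternalSolutions
import Summits.NavierStokesRegularity.NavierStokesRegularity.Theses.TaoLadderRungTwoBreak
import Summits.NavierStokesRegularity.NavierStokesRegularity.Theorems.TaoLadderRungTwoBreakNoSurvivingEternalViscBddOneUpwardFluxRung
import Summits.NavierStokesRegularity.NavierStokesRegularity.Theorems.TaoLadderRungTwoBreakNoSurvivingEternalViscBddOneUpwardFluxBackscatter
import Summits.NavierStokesRegularity.NavierStokesRegularity.Theorems.TaoLadderRungTwoBreakNoLoudLadderOne.Negative.NoLoudLadderOneFalseOfViscousBlockDSSWaves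
import HarnessLib

/-!
# Crux `TaoLadderRungTwoBreak.NoSurvivingEternalViscBddOne` (stmt-NavierStokesRegularity-20419), child (ρ+) `NoLoudLadderOne`:
# what an H-witness (`ViscousBlockDSSWaves`) must pay — the LOG-ACTION / BACKSCATTER ALTERNATIVE for block-self-similar profiles

MODEL lattice ODEs only (Tao 2016 §4, §6.4); nothing here is a statement about the Navier–Stokes equations; no stub, crux or summit is closed
(`--supports stmt-NavierStokesRegularity-20419`).  The construction H = `ViscousBlockDSSWaves` (tree `…/Negative/NoLoudLadderOneFalseOfViscousBlockDSSWaves`: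
H ⇒ ¬(ρ+) ⇒ ¬K1ᵛ(1)) asks, on a fixed class `E₂(R)` and at arbitrarily small `ε₀`, for a non-trivial uniformly bounded admissible eternal
solution with covariant viscosity `ν̂ > 0` that is BLOCK-SELF-SIMILAR (`W_{n+p}(σ) = W_n(σ − T)`); such an object is forward (S₁)-surviving
(`survivingFwd_of_viscBlockDSS`).  The tree already knows it must be TALL (`blockSelfSimilar_amplitude_floor`: `sup‖W‖ ≳ 1/(5C_Aε₀)`).  The
upward-flux rungs of this hand add that it must be EXPENSIVE OR BACKSCATTERING:

* `viscBlockDSS_exists_action_gt_log` — if its bond fluxes are sign-coherent (`⟪W_{k+1}, A W_k⟫ ≥ 0`: no backscatter), some shell carries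
  action `∫‖W_n‖ > log(1/ε₀)/512` (`0 < ε₀ < 1`);
* `viscBlockDSS_not_backscatterBudget` — in general, with per-shell actions `≤ M` and relative backscatter `≤ β` on every bond, the wake
  budget must FAIL: `1 − β ≤ (1+ε₀)(ρ+β)`, `ρ = 1 − e^{−κ}/(1+κ)`, `κ = 2C_AΛ⁻¹M`.

READING (kill-criterion census of ⟨20419⟩/⟨20452⟩): a fixed-seed clock box refuting K1ᵛ(1) along `ε₀ → 0` must either let its per-shell
action grow like `log(1/ε₀)` or hand a fixed fraction of every bond's traffic back down the ladder.  HONEST LABEL: H remains unconstructed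
and unrefuted; (ρ+), ⟨20419⟩ and every NS statement remain OPEN.
-/

noncomputable section

-- the summit and its single sub-problem share the name (CONVENTIONS §1)
set_option linter.dupNamespace false

namespace Summit.NavierStokesRegularity.NavierStokesRegularity.Theorems.NoSurvivingEternalViscBddOne.UpwardFlux

open Set Filter Topology MeasureTheory
open scoped RealInnerProductSpace
open Literature.Analysis.FluidPDE Literature.Analysis.FluidPDE.TaoCascade
open Summit.NavierStokesRegularity.NavierStokesRegularity.Theses.TaoLadderRungTwoBreak
open Summit.NavierStokesRegularity.NavierStokesRegularity.Cruxes.EternalViscousRate.DissipationEdge (survivingFwd_of_viscBlockDSS)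

/-- **An H-witness without backscatter is expensive.**  A non-trivial block-self-similar uniformly bounded admissible eternal solution with
`ν̂ > 0` on a table of `InTableClass R`, `0 < ε₀ < 1`, whose bond fluxes are all non-negative carries action `> log(1/ε₀)/512` on some shell.
[cite: Tao2016AveragedNS, §4 Thm. 4.2 (statement shape), Lemma 4.1 (4.8)–(4.10), §6.4; this file] -/
theorem viscBlockDSS_exists_action_gt_log {R ε₀ νh : ℝ} (hε : 0 < ε₀) (hε1 : ε₀ < 1) (hν : 0 < νh)
    {α : Fin 4 → Fin 4 → Fin 4 → ℤ × ℤ × ℤ → ℝ} (hα : InTableClass R α) {W : ℤ → ℝ → Em 4}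
    (hW : IsEternalVisc ε₀ νh α W) (hU : UniformBound W) {p : ℕ} (hp : 0 < p) {T : ℝ}
    (hD : ∀ (n : ℤ) (σ : ℝ), W (n + p) σ = W n (σ - T)) {n₁ : ℤ} {σ₁ : ℝ} (hne : W n₁ σ₁ ≠ 0)
    (hF : ∀ (j : ℤ) (s : ℝ), 0 ≤ physFlux ε₀ α W j s) :
    ∃ n : ℤ, Real.log (1 / ε₀) / 512 < ∫ s, ‖W n s‖ :=
  exists_action_gt_log_of_survivingFwd hε hε1 hα hW hU hF (survivingFwd_of_viscBlockDSS hε hν hW hp hD hne)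

/-- **An H-witness must break the wake budget.**  For a non-trivial block-self-similar uniformly bounded admissible eternal solution with
`ν̂ > 0` of a cancelling table at `ε₀ > 0`, with per-shell actions `≤ M` and backscatter majorants `b_j ≥ max(−F_j,0)` (continuous,
integrable) obeying the relative budget `∫ b_j ≤ β·Φ_j` (`0 ≤ β < 1`):  `1 − β ≤ (1+ε₀)·(ρ+β)`, `ρ = 1 − e^{−κ}/(1+κ)`, `κ = 2C_AΛ⁻¹M`.
[cite: Tao2016AveragedNS, §4 Thm. 4.2 (statement shape), Lemma 4.1 (4.8)–(4.10), §6.4; this file] -/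
theorem viscBlockDSS_not_backscatterBudget {ε₀ νh : ℝ} (hε : 0 < ε₀) (hν : 0 < νh)
    {α : Fin 4 → Fin 4 → Fin 4 → ℤ × ℤ × ℤ → ℝ} (hc : IsCancellingCoeff α) {W : ℤ → ℝ → Em 4}
    (hW : IsEternalVisc ε₀ νh α W) (hU : UniformBound W) {p : ℕ} (hp : 0 < p) {T : ℝ}
    (hD : ∀ (n : ℤ) (σ : ℝ), W (n + p) σ = W n (σ - T)) {n₁ : ℤ} {σ₁ : ℝ} (hne : W n₁ σ₁ ≠ 0)
    {M : ℝ} (hM : ∀ n, ∫ s, ‖W n s‖ ≤ M)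
    {b : ℤ → ℝ → ℝ} (cb : ∀ j, Continuous (b j)) (ib : ∀ j, Integrable (b j)) (hb0 : ∀ j s, 0 ≤ b j s)
    (hbF : ∀ j s, -physFlux ε₀ α W j s ≤ b j s) {β : ℝ} (hβ0 : 0 ≤ β) (hβ1 : β < 1)
    (hB : ∀ j, ∫ s, b j s ≤ β * ∫ s, physFlux ε₀ α W j s) :
    1 - β ≤ (1 + ε₀) * ((1 - Real.exp (-(2 * fluxConst α * (bigLam ε₀)⁻¹ * M))
      / (1 + 2 * fluxConst α * (bigLam ε₀)⁻¹ * M) + β)) := by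
  by_contra h
  push Not at h
  exact not_survivingFwd_of_backscatterBudget hε hW hc hU hM cb ib hb0 hbF hβ0 hβ1 hB h
    (survivingFwd_of_viscBlockDSS hε hν hW hp hD hne)

/-- **Reading against H by name**: `ViscousBlockDSSWaves` provides, at one spread `R ≥ 1` and every `ε > 0`, a witness at some `ε₀ ≤ ε`; if that
witness has sign-coherent bond fluxes and `ε < 1`, it carries action `> log(1/ε₀)/512 ≥ log(1/ε)/512` on some shell — the sought fixed-seed
clock boxes get logarithmically expensive as `ε₀ → 0` unless they backscatter.
[cite: Tao2016AveragedNS, §4 Thm. 4.2 (statement shape), §6.4; this file] -/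
theorem viscousBlockDSSWaves_expensive_of_upwardFlux
    (hH : Theorems.WakeRatchetViscDSS.ViscousBlockDSSWaves) :
    ∃ R : ℝ, 1 ≤ R ∧ ∀ ε : ℝ, 0 < ε → ε < 1 → ∃ ε₀ : ℝ, 0 < ε₀ ∧ ε₀ ≤ ε ∧
      ∃ α : Fin 4 → Fin 4 → Fin 4 → ℤ × ℤ × ℤ → ℝ, InTableClass R α ∧
        ∃ (νh : ℝ) (W : ℤ → ℝ → Em 4), 0 < νh ∧ IsEternalVisc ε₀ νh α W ∧ UniformBound W ∧
          ((∀ (j : ℤ) (s : ℝ), 0 ≤ physFlux ε₀ α W j s) → ∃ n : ℤ, Real.log (1 / ε) / 512 < ∫ s, ‖W n s‖) := by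
  obtain ⟨R, hR, hHR⟩ := hH
  refine ⟨R, hR, fun ε hε hε1 => ?_⟩
  obtain ⟨ε₀, hε₀, hle, α, hα, νh, W, p, T, hν, hp, hW, hU, hD, n₁, σ₁, hne⟩ := hHR ε hε
  refine ⟨ε₀, hε₀, hle, α, hα, νh, W, hν, hW, hU, fun hF => ?_⟩
  obtain ⟨n, hn⟩ := viscBlockDSS_exists_action_gt_log hε₀ (lt_of_le_of_lt hle hε1) hν hα hW hU hp hD hne hF
  refine ⟨n, lt_of_le_of_lt ?_ hn⟩
  have h1 : Real.log (1 / ε) ≤ Real.log (1 / ε₀) :=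
    Real.log_le_log (by positivity) (one_div_le_one_div_of_le hε₀ hle)
  linarith

end Summit.NavierStokesRegularity.NavierStokesRegularity.Theorems.NoSurvivingEternalViscBddOne.UpwardFlux

end
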